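import Mathlib
import Summits.Ventures.PercRepro2.Defs
import Summits.Ventures.PercRepro2.Harris
import Summits.Ventures.PercRepro2.Graph
import Summits.Ventures.PercRepro2.Induced
import Summits.Ventures.PercRepro2.WForm
import Summits.Ventures.PercRepro2.WStatus
import Summits.Ventures.PercRepro2.WAltDefs
import Summits.Ventures.PercRepro2.WAltTheorem
import Summits.Ventures.PercRepro2.WStatusDict

/-!
# THE W-INEQUALITY FOR EVERY TEST SET AND EVERY AVOIDED SET (blind cell PercRepro2, mine-1 g15)
proofs/MINE1-W-THEOREM.md; row 2′W of conjectures/CONJECTURES.md (`WRow`, WStatus.lean).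

**Main theorem** (`wIneqStatus_all`, `WRow_holds`): for every finite graph, every admissible weight
vector `p`, every root `s`, every avoided set `T` and every test set `F`, the status law
`W_S = P(C(s) ∩ F = S, C(s) ∩ T = ∅)` satisfies the W-inequality
`∑_{S ∩ S' = ∅} W_S W_{S'} (g S − g S')(h S − h S') ≥ 0` for all monotone `g, h : Finset V → R`
(`WIneqStatus p ends s T F`). Before this file the tree had `|F| ≤ 2, T = ∅` (WTwo.lean) and the
reduction `|F| = 2 ⟺ two-point inequality` (WTwoIff.lean); the census stood at `n ≤ 7`.

**Proof** — the alternating-Harris (Gibbs-sampler) argument on the pair of clusters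
(`WForm.Q_nonneg_of_alternating`, WAltTheorem.lean) applied to `D = Disjoint`, `W = statusW`, with
van den Berg–Häggström–Kahn's conditional positive association as the hypothesis (H1)
(`condPA_statusW`, WStatusDict.lean) and the empty status as the hub. If `W ∅ = 0` the W-form
vanishes identically: two disjoint statuses of positive weight would give, through the meet of two
witnessing configurations, a configuration of positive weight with empty status avoiding `T`
(`statusW_mul_eq_zero_of_disjoint`).
-/

namespace Summit.Ventures.PercRepro2

section Main

variable {V : Type*} {E : Type*} [Fintype E] [DecidableEq E] [Fintype V] [DecidableEq V]
  {R : Type*} [Field R] [LinearOrder R] [IsStrictOrderedRing R]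
variable (p : E → R) (ends : E → Sym2 V) (s : V) (T F : Finset V)

omit [Fintype V] [DecidableEq V] in
/-- A positive probability has a configuration of positive weight. -/
lemma exists_pos_weight_of_prob_ne_zero (hp : IsProbVec p) {A : Set (Config E)}
    (h : prob p A ≠ 0) : ∃ ω ∈ A, 0 < weight p ω := by
  unfold prob at h
  obtain ⟨ω, _, hω⟩ := Finset.exists_ne_zero_of_sum_ne_zero h
  by_cases hA : ω ∈ A
  · refine ⟨ω, hA, ?_⟩
    rw [Set.indicator_of_mem hA] at hω
    exact lt_of_le_of_ne (weight_nonneg hp ω) (Ne.symm hω)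
  · rw [Set.indicator_of_notMem hA] at hω; exact absurd rfl hω

omit [DecidableEq E] [Fintype V] [DecidableEq V] in
/-- The pointwise meet of two configurations of positive weight has positive weight. -/
lemma weight_meet_pos (hp : IsProbVec p) {ω ω' : Config E} (h : 0 < weight p ω)
    (h' : 0 < weight p ω') : 0 < weight p (fun e => ω e && ω' e) := by
  unfold weight at *
  have h1 := Finset.prod_ne_zero_iff.mp h.ne'
  have h1' := Finset.prod_ne_zero_iff.mp h'.ne'
  refine Finset.prod_pos fun e _ => ?_
  refine lt_of_le_of_ne (edgeFactor_nonneg (hp.1 e) (hp.2 e) _) (Ne.symm ?_)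
  have he := h1 e (Finset.mem_univ e)
  have he' := h1' e (Finset.mem_univ e)
  show edgeFactor (p e) (ω e && ω' e) ≠ 0
  cases hωe : ω e <;> cases hω'e : ω' e
  · rw [hωe] at he; simpa using he
  · rw [hωe] at he; simpa using he
  · rw [hω'e] at he'; simpa using he'
  · rw [hωe] at he; simpa using he

omit [Fintype V] [DecidableEq V] in
/-- A configuration in `A` of positive weight gives `prob p A > 0`. -/
lemma prob_pos_of_mem (hp : IsProbVec p) {A : Set (Config E)} {ω : Config E} (hω : ω ∈ A)
    (h : 0 < weight p ω) : 0 < prob p A := by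
  unfold prob
  refine lt_of_lt_of_le ?_ (Finset.single_le_sum (f := fun ω => A.indicator (weight p) ω)
    (fun ω _ => Set.indicator_nonneg (fun ω _ => weight_nonneg hp ω) ω) (Finset.mem_univ ω))
  simpa only [Set.indicator_of_mem hω] using h

omit [Fintype E] [DecidableEq E] [Fintype V] [DecidableEq V] in
/-- The meet is below its left argument. -/
lemma meet_le_left (ω ω' : Config E) : (fun e => ω e && ω' e) ≤ ω :=
  fun e => Bool.and_le_left (ω e) (ω' e)

omit [Fintype E] [DecidableEq E] [Fintype V] [DecidableEq V] in
/-- The meet is below its right argument. -/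
lemma meet_le_right (ω ω' : Config E) : (fun e => ω e && ω' e) ≤ ω' :=
  fun e => Bool.and_le_right (ω e) (ω' e)

omit [Fintype V] in
/-- **The degenerate case**: if the empty status has weight `0`, no two disjoint statuses both
have positive weight (the meet of two witnessing configurations has positive weight, empty
status and avoids `T`). -/
lemma statusW_mul_eq_zero_of_disjoint (hp : IsProbVec p)
    (h0 : statusW p ends s T F ∅ = 0) {S S' : Finset V} (hSS' : Disjoint S S') :
    statusW p ends s T F S * statusW p ends s T F S' = 0 := by
  by_contra hne
  have hS : statusW p ends s T F S ≠ 0 := left_ne_zero_of_mul hne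
  have hS' : statusW p ends s T F S' ≠ 0 := right_ne_zero_of_mul hne
  unfold statusW at hS hS' h0
  by_cases hSF : S ⊆ F
  swap
  · exact hS (if_neg hSF)
  by_cases hS'F : S' ⊆ F
  swap
  · exact hS' (if_neg hS'F)
  rw [if_pos hSF] at hS
  rw [if_pos hS'F] at hS'
  rw [if_pos (Finset.empty_subset F)] at h0
  unfold statusMass at hS hS' h0
  obtain ⟨ω, hω, hw⟩ := exists_pos_weight_of_prob_ne_zero p hp hS
  obtain ⟨ω', hω', hw'⟩ := exists_pos_weight_of_prob_ne_zero p hp hS'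
  have hmeet := weight_meet_pos p hp hw hw'
  have hmem : (fun e => ω e && ω' e) ∈ connAll ends s ∅ ∩ avoidAll ends s (T ∪ (F \ ∅)) := by
    refine ⟨fun a ha => absurd ha (Finset.notMem_empty a), fun x hx hc => ?_⟩
    rw [Finset.sdiff_empty] at hx
    rcases Finset.mem_union.mp hx with hx | hx
    · exact hω.2 x (Finset.mem_union_left _ hx) (conn_mono (meet_le_left ω ω') hc)
    · by_cases hxS : x ∈ S
      · have hxS' : x ∉ S' := Finset.disjoint_left.mp hSS' hxS
        exact hω'.2 x (Finset.mem_union_right _ (Finset.mem_sdiff.mpr ⟨hx, hxS'⟩))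
          (conn_mono (meet_le_right ω ω') hc)
      · exact hω.2 x (Finset.mem_union_right _ (Finset.mem_sdiff.mpr ⟨hx, hxS⟩))
          (conn_mono (meet_le_left ω ω') hc)
  exact (prob_pos_of_mem p hp hmem hmeet).ne' h0

/-- In the degenerate case the W-form vanishes identically. -/
lemma Q_statusW_eq_zero_of_empty (hp : IsProbVec p) (h0 : statusW p ends s T F ∅ = 0)
    (g h : Finset V → R) :
    WForm.Q (fun S S' : Finset V => Disjoint S S') (statusW p ends s T F) g h = 0 := by
  unfold WForm.Q WForm.S
  refine Finset.sum_eq_zero fun S _ => Finset.sum_eq_zero fun S' _ => ?_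
  unfold WForm.coef
  split_ifs with hD
  · rw [statusW_mul_eq_zero_of_disjoint p ends s T F hp h0 hD, zero_mul]
  · exact zero_mul _

/-- **THE W-INEQUALITY** (row 2′W): for every admissible weight vector, root, avoided set and
test set, the status law satisfies the W-inequality. -/
theorem wIneqStatus_all [Archimedean R] (hp : IsProbVec p) : WIneqStatus p ends s T F := by
  refine ⟨statusW_nonneg ends s T F hp, ?_⟩
  intro g h hg hh
  by_cases h0 : 0 < statusW p ends s T F ∅
  · exact WForm.Q_nonneg_of_alternating (statusW_nonneg ends s T F hp)
      (fun _ _ hSS' => hSS'.symm) (fun _ _ _ hle hd => hd.mono_left hle) ∅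
      (fun t => Finset.disjoint_empty_left t) h0 (condPA_statusW p ends s T F hp) hg hh
  · have hW0 : statusW p ends s T F ∅ = 0 :=
      le_antisymm (not_lt.mp h0) (statusW_nonneg ends s T F hp ∅)
    rw [Q_statusW_eq_zero_of_empty p ends s T F hp hW0 g h]

end Main

/-- **The conjecture of record `WRow` holds.** -/
theorem WRow_holds : WRow := fun p hp ends s T F _ _ => wIneqStatus_all p ends s T F hp

end Summit.Ventures.PercRepro2
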